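import Mathlib.Combinatorics.SetFamily.HarrisKleitman
import Mathlib.Data.Finset.Sups

/-!
# `NoHeavyLowerTail` (crux stmt-CriticalPhenomena-4575), lane prim-ineq-gen-4 (gen 20): the anti-band inequality (AB_l) holds whenever one of the two
# up-sets has no "positive" small member (the degenerate / Kleitman² case)

Support file (`--supports stmt-CriticalPhenomena-4575`; memo `run/shared/lean/prim/prim-ineq-gen-4/FINDING-SHIFTING-AB-g20.md` §3, §7 step (i)).
Pure finite combinatorics, no definitions, no `sorry`, standard axioms.

(AB_l) for up-sets `W, V` of finsets of `β` asks `#{s ∈ W ∩ Vᶜˢ | outer s} ≤ #{s ∈ W ∩ V | outer s}` with `outer s :↔ #s < l ∨ #sᶜ < l`.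
A small member `s ∈ W` (`#s < l`) is *positive* when `sᶜ ∉ W`.  All tight cases found by the gen-20 census have a side without positive small members; in that
case (AB_l) follows from two applications of the Harris–Kleitman inequality: for the lower set `N = {u : #u < l, uᶜ ∈ W, u ∉ W}` one has
`#(N ∩ V) ≤ #N·#V / 2^n ≤ #(Nᶜˢ ∩ V)`, and the remaining members of the two counted families are matched by complementation.

* `isUpperSet_compls_of_isLowerSet`        : complements of a lower set family form an upper set family,
* `card_inter_le_card_compls_inter`         : Kleitman twice: `#(N ∩ V) ≤ #(Nᶜˢ ∩ V)` for `N` lower, `V` upper,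
* `antiBand_of_no_positive`                 : (AB_l) when `W` has no positive member of size `< l`.
-/

namespace Summit.CriticalPhenomena.PercolationContinuityZ3.Theorems.AntiBandDegenerate

open Finset
open scoped FinsetFamily

variable {β : Type*} [DecidableEq β] [Fintype β]

/-- The family of complements of a lower set of finsets is an upper set. [folklore] -/
theorem isUpperSet_compls_of_isLowerSet {N : Finset (Finset β)} (hN : IsLowerSet (N : Set (Finset β))) :
    IsUpperSet ((Nᶜˢ : Finset (Finset β)) : Set (Finset β)) := by
  intro a b hab ha
  rw [mem_coe, mem_compls] at ha ⊢
  exact hN (compl_subset_compl.2 hab) ha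

/-- **Kleitman twice.** For a lower set `N` and an upper set `V` of finsets of `β`: `#(N ∩ V) ≤ #(Nᶜˢ ∩ V)`
(`2^n·#(N∩V) ≤ #N·#V = #Nᶜˢ·#V ≤ 2^n·#(Nᶜˢ ∩ V)` by the Harris–Kleitman inequality). [Kleitman 1966; Harris 1960] -/
theorem card_inter_le_card_compls_inter (N V : Finset (Finset β)) (hN : IsLowerSet (N : Set (Finset β)))
    (hV : IsUpperSet (V : Set (Finset β))) : #(N ∩ V) ≤ #(Nᶜˢ ∩ V) := by
  have h1 : 2 ^ Fintype.card β * #(N ∩ V) ≤ #N * #V := hN.card_inter_le_finset hV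
  have h2 : #(Nᶜˢ) * #V ≤ 2 ^ Fintype.card β * #(Nᶜˢ ∩ V) :=
    (isUpperSet_compls_of_isLowerSet hN).le_card_inter_finset hV
  rw [card_compls] at h2
  exact Nat.le_of_mul_le_mul_left (h1.trans h2) (Nat.two_pow_pos _)

/-- **(AB_l) in the degenerate case.**  If the up-set `W` has no positive member of size `< l` (every `s ∈ W` with `#s < l` has `sᶜ ∈ W`), then for
every up-set `V`: `#{s ∈ W ∩ Vᶜˢ | #s < l ∨ #sᶜ < l} ≤ #{s ∈ W ∩ V | #s < l ∨ #sᶜ < l}`.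
Proof: complementation sends the counted members `s` of `W ∩ Vᶜˢ` with (`#s < l` or `sᶜ ∈ W`) injectively into the counted members `y` of `W ∩ V` with
`yᶜ ∈ W`; the others have `sᶜ` in the lower set `N = {u : #u < l, uᶜ ∈ W, u ∉ W}` and in `V`, and `#(N ∩ V) ≤ #(Nᶜˢ ∩ V)` (Kleitman twice), where
`Nᶜˢ ∩ V` consists of counted members `y` of `W ∩ V` with `yᶜ ∉ W`. [gen 20, FINDING-SHIFTING-AB-g20.md §7(i)] -/
theorem antiBand_of_no_positive (l : ℕ) (W V : Finset (Finset β)) (hW : IsUpperSet (W : Set (Finset β)))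
    (hV : IsUpperSet (V : Set (Finset β))) (hneg : ∀ s ∈ W, #s < l → sᶜ ∈ W) :
    #((W ∩ Vᶜˢ).filter fun s => #s < l ∨ #sᶜ < l) ≤ #((W ∩ V).filter fun s => #s < l ∨ #sᶜ < l) := by
  classical
  set X := (W ∩ Vᶜˢ).filter fun s => #s < l ∨ #sᶜ < l with hX
  set Y := (W ∩ V).filter fun s => #s < l ∨ #sᶜ < l with hY
  set N : Finset (Finset β) := univ.filter fun u => #u < l ∧ uᶜ ∈ W ∧ u ∉ W with hNdef
  have hN : IsLowerSet (N : Set (Finset β)) := by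
    intro a b hba ha
    rw [mem_coe, hNdef, mem_filter] at ha ⊢
    obtain ⟨-, h1, h2, h3⟩ := ha
    refine ⟨mem_univ _, lt_of_le_of_lt (card_le_card hba) h1, ?_, fun hb => h3 (hW hba hb)⟩
    exact hW (compl_subset_compl.2 hba) h2
  -- membership unpacking for X
  have memX : ∀ {s}, s ∈ X → s ∈ W ∧ sᶜ ∈ V ∧ (#s < l ∨ #sᶜ < l) := by
    intro s hs
    rw [hX, mem_filter, mem_inter, mem_compls] at hs
    exact ⟨hs.1.1, hs.1.2, hs.2⟩
  let p : Finset β → Prop := fun s => #s < l ∨ sᶜ ∈ W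
  -- (1) the members of X with (#s < l or sᶜ ∈ W) go injectively, by complementation, to members y of Y with yᶜ ∈ W
  have h1 : #(X.filter p) ≤ #(Y.filter fun y => yᶜ ∈ W) := by
    rw [← card_image_of_injective (X.filter p) compl_injective]
    apply card_le_card
    intro y hy
    rw [mem_image] at hy
    obtain ⟨s, hs, rfl⟩ := hy
    rw [mem_filter] at hs
    obtain ⟨hsX, hps⟩ := hs
    obtain ⟨hsW, hscV, hsize⟩ := memX hsX
    have hscW : sᶜ ∈ W := by
      rcases hps with h | h
      · exact hneg s hsW h
      · exact h
    rw [mem_filter, hY, mem_filter, mem_inter, compl_compl]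
    refine ⟨⟨⟨hscW, hscV⟩, ?_⟩, hsW⟩
    rcases hsize with h | h
    · exact Or.inr h
    · exact Or.inl h
  -- (2) the other members of X go injectively to N ∩ V
  have h2 : #(X.filter fun s => ¬ p s) ≤ #(N ∩ V) := by
    rw [← card_image_of_injective (X.filter fun s => ¬ p s) compl_injective]
    apply card_le_card
    intro y hy
    rw [mem_image] at hy
    obtain ⟨s, hs, rfl⟩ := hy
    rw [mem_filter] at hs
    obtain ⟨hsX, hps⟩ := hs
    obtain ⟨hsW, hscV, hsize⟩ := memX hsX
    have hns : ¬ #s < l := fun h => hps (Or.inl h)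
    have hscW : sᶜ ∉ W := fun h => hps (Or.inr h)
    have hsmall : #sᶜ < l := hsize.resolve_left hns
    rw [mem_inter, hNdef, mem_filter, compl_compl]
    exact ⟨⟨mem_univ _, hsmall, hsW, hscW⟩, hscV⟩
  -- (3) Kleitman twice
  have h3 : #(N ∩ V) ≤ #(Nᶜˢ ∩ V) := card_inter_le_card_compls_inter N V hN hV
  -- (4) Nᶜˢ ∩ V consists of members y of Y with yᶜ ∉ W
  have h4 : #(Nᶜˢ ∩ V) ≤ #(Y.filter fun y => ¬ yᶜ ∈ W) := by
    apply card_le_card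
    intro y hy
    rw [mem_inter, mem_compls, hNdef, mem_filter, compl_compl] at hy
    obtain ⟨⟨-, hsmall, hyW, hycW⟩, hyV⟩ := hy
    rw [mem_filter, hY, mem_filter, mem_inter]
    exact ⟨⟨⟨hyW, hyV⟩, Or.inr hsmall⟩, hycW⟩
  have hsplitX := card_filter_add_card_filter_not (s := X) p
  have hsplitY := card_filter_add_card_filter_not (s := Y) (fun y => yᶜ ∈ W)
  omega

end Summit.CriticalPhenomena.PercolationContinuityZ3.Theorems.AntiBandDegenerate
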